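import Summits.QuantumFields.YangMills.Theorems.SwapVirialDeficitSwapRingCeiling
import Summits.QuantumFields.YangMills.Theorems.ToronValleyVolumePeriodicRingCeiling
import Summits.QuantumFields.YangMills.Theorems.SwapVirialDeficitSwapRingSectorLaplace
import HarnessLib

/-!
# The fixed-`L` CEILING of the σ-glued ring, III: the zero-σ-sector volume and Laplace ceilings `C_L·u^{9L⁴−1}`, `C_L·β^{−(9L⁴−1)}` — NO logarithm —
# PARAMETRIC in a σ-twisted four-leader ceiling `Haar⁴{σ-twisted leaders at s} ≤ C·s⁷`
# (free-hands support of item stmt-QuantumFields-24197 `SwapVirialDeficit.SwapGluedStiffness`; brick (β-ii)/(B-v, sector 0) of LEAD ym-line-sfw-p2 g93's 06:58Z plan;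
# the other half of ✓`SwapRing.swap_volume_floor` / ✓`swap_laplace_floor_of_leaderVolume`)

* §3 (the log-free abstract Laplace ceiling ✓`integral_exp_neg_mul_le_of_pow_volume` lives in ✓`SwapVirialDeficitSwapRingSectorLaplace`, the (B-v) interface file)
  `swapCommSet_subset_quat` (Frobenius event at `s` ⊆ quaternion event at `s/√2` — the bridge to the convention of ✓`SigmaTwistedLetterFloor.haar_pi_sigmaTwisted_ge`
  and LEAD g93's `SigmaTwistedCeiling.haar_pi_sigmaTwisted_le`), ★★ `swap_volume_ceiling_of_leaderCeiling` (`μ_L{F^S_0 ≤ u} ≤ C_L·u^{9L⁴−1}` on `(0,u₀]`: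
  ✓`ringMeasure_real_swapDeficit_le_le_box`, `ballVol ≤ 4r³` ✓`PeriodicRingCeiling.ballVol_le_four_mul_cube`, `7 + 3(6L⁴−3) = 2(9L⁴−1)` half-powers),
  ★★ `swap_laplace_ceiling_of_leaderCeiling` (`∫e^{−βF^S_0}dμ_L ≤ C_L/β^{9L⁴−1}` for ALL `β > 0`).
With LEAD's ceiling the zero σ-sector weight `e^{12βL⁴}∫e^{−βF^S_0}` is `≍ e^{12βL⁴}β^{−(9L⁴−1)}` TWO-SIDED at every fixed `L` (floor: ✓`swap_laplace_floor_of_leaderVolume`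
+ ✓`swapCommVolume`).
HONEST LABEL: the sector `z = 0` only — the `TT.twistTrace` ceiling needs the seven twisted σ-sectors ((B-iii)/(B-iv) w2 g54, general-`z` box fcl-p3 g43) and is
NOT proved here; constants `exp(O(L⁴ log L))`; ⟨24197⟩, ⟨24194⟩, ⟨24497⟩, ⟨24196⟩ stay OPEN; no crux, rung or summit is proved; the Yang–Mills mass gap is NOT
proved; no summit is proved by a line.  THEOREMS ONLY (0 `def`, 0 `sorry`), standard axioms.  Width seat ym-line-sfw-p2-w3 g61 (cell ym-idea-1, free hands),
`--supports stmt-QuantumFields-24197`.  References: [cite: tHooft1979]; [cite: Luscher1983, §2]; [cite: Vanbaal2001]; [cite: GonzalezarroyoAltes1988]; [folklore].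
-/

set_option autoImplicit false

noncomputable section

open MeasureTheory Set
open scoped BigOperators ENNReal Nat
open Literature.MathematicalPhysics.QuantumFieldTheory hiding SU2
open Literature.MathematicalPhysics.QuantumLattice

namespace Summit.QuantumFields.YangMills.Theorems.SwapVirialDeficit.SwapRing

open Summit.QuantumFields.YangMills.Theorems.FemtoTransferGap
open Summit.QuantumFields.YangMills.Theorems.FemtoTransferGap.TT
open Summit.QuantumFields.YangMills.Theorems.VirialFluxGap.RingDeficit
open Summit.QuantumFields.YangMills.Theorems.VirialFluxGap.FixSplit (card_offIdx)
open Summit.QuantumFields.YangMills.Theorems.SwapTwistDeficit.PeriodicRingFloor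
open Summit.QuantumFields.YangMills.Theorems.ToronValleyVolume.PeriodicRingCeiling (ballVol_le_four_mul_cube)

variable {L : ℕ} [NeZero L]

/-! ## §3 The zero σ-sector ceilings, parametric in a σ-twisted four-leader ceiling -/

/-- The Frobenius σ-twisted leader event at radius `s` IS the quaternion event at radius `s/√2` (`‖A − B‖_F = √2·‖q(A) − q(B)‖`): the bridge to the
quaternion convention of ✓`SigmaTwistedLetterFloor.haar_pi_sigmaTwisted_ge` / `SigmaTwistedCeiling.haar_pi_sigmaTwisted_le`. [folklore] -/
theorem swapCommSet_subset_quat (s : ℝ) :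
    {C : Fin 4 → SU2 |
      (∀ μ ν : Fin 3, frobNorm (((C (Fin.castSucc μ) * C (Fin.castSucc ν) : SU2) : Matrix (Fin 2) (Fin 2) ℂ) -
        ((C (Fin.castSucc ν) * C (Fin.castSucc μ) : SU2) : Matrix (Fin 2) (Fin 2) ℂ)) ≤ s) ∧
      ∀ μ : Fin 3, frobNorm (((C (Fin.last 3) * C (Fin.castSucc (Equiv.swap (0 : Fin 3) 1 μ)) : SU2) : Matrix (Fin 2) (Fin 2) ℂ) -
        ((C (Fin.castSucc μ) * C (Fin.last 3) : SU2) : Matrix (Fin 2) (Fin 2) ℂ)) ≤ s} ⊆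
    {C : Fin 4 → SU2 |
      (∀ μ ν : Fin 3, ‖su2Quat (C μ.castSucc) * su2Quat (C ν.castSucc) - su2Quat (C ν.castSucc) * su2Quat (C μ.castSucc)‖ ≤ s / Real.sqrt 2) ∧
      ∀ μ : Fin 3, ‖su2Quat (C (Fin.last 3)) * su2Quat (C (Equiv.swap (0 : Fin 3) 1 μ).castSucc) -
        su2Quat (C μ.castSucc) * su2Quat (C (Fin.last 3))‖ ≤ s / Real.sqrt 2} := by
  intro C hC
  simp only [Set.mem_setOf_eq] at hC ⊢
  have h2 : (0 : ℝ) < Real.sqrt 2 := Real.sqrt_pos.2 (by norm_num)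
  have key : ∀ x y x' y' : SU2, frobNorm (((x * y : SU2) : Matrix (Fin 2) (Fin 2) ℂ) - ((x' * y' : SU2) : Matrix (Fin 2) (Fin 2) ℂ)) ≤ s →
      ‖su2Quat x * su2Quat y - su2Quat x' * su2Quat y'‖ ≤ s / Real.sqrt 2 := by
    intro x y x' y' h
    rw [frobNorm_sub_eq_sqrt_two_mul_norm_su2Quat_sub, su2Quat_mul, su2Quat_mul] at h
    rw [le_div_iff₀ h2, mul_comm]; exact h
  exact ⟨fun μ ν => key _ _ _ _ (hC.1 μ ν), fun μ => key _ _ _ _ (hC.2 μ)⟩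

/-- ★★ **THE ZERO-σ-SECTOR VOLUME CEILING, parametric**: from ANY σ-twisted four-leader ceiling `Haar⁴{σ-twisted leaders at s} ≤ C·s⁷` on `(0, s₀]`
(Frobenius event): for every `L` there are `C_L > 0` and `u₀ > 0` with `μ_L{F^S_0 ≤ u} ≤ C_L·u^{9L⁴−1}` for `0 < u ≤ u₀` — leaders at `s = 60L³√u`,
fluctuations in `6L⁴ − 3` balls of radius `48L³√u` (`ballVol ≤ 4r³`), `7 + 3(6L⁴−3) = 2(9L⁴−1)` half-powers of `u`, NO logarithm.
[cite: tHooft1979] [cite: Luscher1983, §2] [cite: GonzalezarroyoAltes1988] -/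
theorem swap_volume_ceiling_of_leaderCeiling {C s₀ : ℝ} (hC : 0 ≤ C) (hs₀ : 0 < s₀)
    (hceil : ∀ s : ℝ, 0 < s → s ≤ s₀ → (Measure.pi fun _ : Fin 4 => haarProbability SU2).real {C : Fin 4 → SU2 |
        (∀ μ ν : Fin 3, frobNorm (((C (Fin.castSucc μ) * C (Fin.castSucc ν) : SU2) : Matrix (Fin 2) (Fin 2) ℂ) -
          ((C (Fin.castSucc ν) * C (Fin.castSucc μ) : SU2) : Matrix (Fin 2) (Fin 2) ℂ)) ≤ s) ∧
        ∀ μ : Fin 3, frobNorm (((C (Fin.last 3) * C (Fin.castSucc (Equiv.swap (0 : Fin 3) 1 μ)) : SU2) : Matrix (Fin 2) (Fin 2) ℂ) -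
          ((C (Fin.castSucc μ) * C (Fin.last 3) : SU2) : Matrix (Fin 2) (Fin 2) ℂ)) ≤ s} ≤ C * s ^ 7) :
    ∃ C' : ℝ, 0 < C' ∧ ∃ u₀ : ℝ, 0 < u₀ ∧ ∀ u : ℝ, 0 < u → u ≤ u₀ →
      (ringMeasure L).real {P | swapRingDeficit L (fun _ => false) P ≤ u} ≤ C' * u ^ (9 * L ^ 4 - 1) := by
  have hL : (0 : ℝ) < L := by exact_mod_cast NeZero.pos L
  have hL1 : 1 ≤ L := NeZero.one_le
  have hL4 : 1 ≤ L ^ 4 := Nat.one_le_pow _ _ hL1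
  set A : ℝ := 60 * (L : ℝ) ^ 3 with hA
  set B : ℝ := 48 * (L : ℝ) ^ 3 with hB
  have hA0 : 0 < A := by positivity
  have hB0 : 0 < B := by positivity
  refine ⟨(C + 1) * A ^ 7 * (4 * B ^ 3) ^ (6 * L ^ 4 - 3), by positivity, (s₀ / A) ^ 2, by positivity, fun u hu0 hu => ?_⟩
  have hsu : 0 < Real.sqrt u := Real.sqrt_pos.2 hu0
  -- the leader radius is admissible: `A√u ≤ s₀`
  have hsA : A * Real.sqrt u ≤ s₀ := by
    have h1 : Real.sqrt u ≤ Real.sqrt ((s₀ / A) ^ 2) := Real.sqrt_le_sqrt hu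
    rw [Real.sqrt_sq (by positivity)] at h1
    calc A * Real.sqrt u ≤ A * (s₀ / A) := mul_le_mul_of_nonneg_left h1 hA0.le
      _ = s₀ := by field_simp
  have hbox := ringMeasure_real_swapDeficit_le_le_box (L := L) u
  have hlead := hceil (A * Real.sqrt u) (by positivity) hsA
  have hball : ballVol (B * Real.sqrt u) ≤ 4 * (B * Real.sqrt u) ^ 3 := ballVol_le_four_mul_cube (by positivity)
  have hball0 : 0 ≤ ballVol (B * Real.sqrt u) := measureReal_nonneg
  have hballpow : ballVol (B * Real.sqrt u) ^ (6 * L ^ 4 - 3) ≤ (4 * (B * Real.sqrt u) ^ 3) ^ (6 * L ^ 4 - 3) :=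
    pow_le_pow_left₀ hball0 hball _
  -- collect the half-powers of `u`
  have hexp : 7 + 3 * (6 * L ^ 4 - 3) = 2 * (9 * L ^ 4 - 1) := by omega
  have hpow : Real.sqrt u ^ 7 * (Real.sqrt u ^ 3) ^ (6 * L ^ 4 - 3) = u ^ (9 * L ^ 4 - 1) := by
    rw [← pow_mul, ← pow_add, hexp, pow_mul, Real.sq_sqrt hu0.le]
  calc (ringMeasure L).real {P | swapRingDeficit L (fun _ => false) P ≤ u}
      ≤ C * (A * Real.sqrt u) ^ 7 * (4 * (B * Real.sqrt u) ^ 3) ^ (6 * L ^ 4 - 3) :=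
        hbox.trans (mul_le_mul hlead hballpow (pow_nonneg hball0 _) (by positivity))
    _ = C * A ^ 7 * (4 * B ^ 3) ^ (6 * L ^ 4 - 3) * (Real.sqrt u ^ 7 * (Real.sqrt u ^ 3) ^ (6 * L ^ 4 - 3)) := by
        have h4 : (4 : ℝ) * (B * Real.sqrt u) ^ 3 = (4 * B ^ 3) * Real.sqrt u ^ 3 := by ring
        rw [h4, mul_pow (4 * B ^ 3), mul_pow A]; ring
    _ = C * A ^ 7 * (4 * B ^ 3) ^ (6 * L ^ 4 - 3) * u ^ (9 * L ^ 4 - 1) := by rw [hpow]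
    _ ≤ (C + 1) * A ^ 7 * (4 * B ^ 3) ^ (6 * L ^ 4 - 3) * u ^ (9 * L ^ 4 - 1) := by
        have : 0 ≤ A ^ 7 * (4 * B ^ 3) ^ (6 * L ^ 4 - 3) * u ^ (9 * L ^ 4 - 1) := by positivity
        nlinarith

/-- ★★ **THE ZERO-σ-SECTOR LAPLACE CEILING, parametric**: from ANY σ-twisted four-leader ceiling `≤ C·s⁷` on `(0, s₀]` (Frobenius event), for every `L`
there is `C_L > 0` with `∫e^{−βF^S_0}dμ_L ≤ C_L / β^{9L⁴−1}` for ALL `β > 0` — so the zero σ-sector weight `e^{12βL⁴}∫e^{−βF^S_0}dμ_L` of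
`Z^S = TT.twistTrace L β (2L)` (✓`twistTrace_eq_sum_exp_mul_integral_deficit`) is `≍ e^{12βL⁴}β^{−(9L⁴−1)}` two-sidedly with ✓`swap_laplace_floor_of_leaderVolume`,
NO logarithm. [cite: tHooft1979] [cite: Luscher1983, §2] [cite: Vanbaal2001] -/
theorem swap_laplace_ceiling_of_leaderCeiling {C s₀ : ℝ} (hC : 0 ≤ C) (hs₀ : 0 < s₀)
    (hceil : ∀ s : ℝ, 0 < s → s ≤ s₀ → (Measure.pi fun _ : Fin 4 => haarProbability SU2).real {C : Fin 4 → SU2 |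
        (∀ μ ν : Fin 3, frobNorm (((C (Fin.castSucc μ) * C (Fin.castSucc ν) : SU2) : Matrix (Fin 2) (Fin 2) ℂ) -
          ((C (Fin.castSucc ν) * C (Fin.castSucc μ) : SU2) : Matrix (Fin 2) (Fin 2) ℂ)) ≤ s) ∧
        ∀ μ : Fin 3, frobNorm (((C (Fin.last 3) * C (Fin.castSucc (Equiv.swap (0 : Fin 3) 1 μ)) : SU2) : Matrix (Fin 2) (Fin 2) ℂ) -
          ((C (Fin.castSucc μ) * C (Fin.last 3) : SU2) : Matrix (Fin 2) (Fin 2) ℂ)) ≤ s} ≤ C * s ^ 7) :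
    ∃ C' : ℝ, 0 < C' ∧ ∀ β : ℝ, 0 < β →
      ∫ P, Real.exp (-(β * swapRingDeficit L (fun _ => false) P)) ∂(ringMeasure L) ≤ C' / β ^ (9 * L ^ 4 - 1) := by
  haveI := isProbabilityMeasure_ringMeasure (L := L)
  obtain ⟨C₁, hC₁, u₀, hu₀, hvol⟩ := swap_volume_ceiling_of_leaderCeiling (L := L) hC hs₀ hceil
  refine ⟨(C₁ + (u₀ ^ (9 * L ^ 4 - 1))⁻¹) * (9 * L ^ 4 - 1) !, by positivity, fun β hβ => ?_⟩
  exact integral_exp_neg_mul_le_of_pow_volume (μ := ringMeasure L) (swapRingDeficit L (fun _ => false)) (measurable_swapRingDeficit _)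
    (swapRingDeficit_nonneg (L := L) (fun _ => false)) hC₁.le hu₀ (9 * L ^ 4 - 1) hvol hβ

end Summit.QuantumFields.YangMills.Theorems.SwapVirialDeficit.SwapRing

end
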